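import Literature.NumberTheory.EllipticCurves.ModularParametrizationDegreeProofs
import Literature.NumberTheory.EllipticCurves.HeckeOperatorsAdjointProofs
import HarnessLib

/-!
# The Petersson norm on `Γ₀(N)` as an area integral over a fundamental domain

Groundwork for the proof of Zagier's degree formula
(`ModularParametrizationData.zagier_degree_formula`, proved in
`Literature/NumberTheory/EllipticCurves/ModularDegreeFormulaProofs.lean`): the passage from the
tree's Petersson product `peterssonProduct (Gamma0 N) 2 f f = ∫_𝒟 ∑_{q ∈ 𝒮ℒ/Γ₀(N)} |f|² y² (q̃⁻¹ τ) dμ`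
(Diamond–Shurman Def. 5.4.1 without the volume factor; `HeckeOperators.lean`) to the Lebesgue
integral `∬_F |f(x+iy)|² dx dy` over a fundamental domain `F` of `Γ₀(N)` in `ℍ ⊆ ℂ`
(Zagier 1985, §1: "`‖f‖² = ∬_{Γ∖ℍ} |f|² du dv`"; Diamond–Shurman §5.4, p. 182: the integral over
`X(Γ)` as a sum over coset representatives `⋃ⱼ αⱼ(𝒟)`).

* **The domain.** For a system `g : 𝒮ℒ/Γ₀(N) → SL(2, ℤ)` of representatives of the left cosets
  (`exists_mapGL_eq_out`) we use `F = ⋃_q {τ | g_q τ ∈ 𝒟ᵒ} = ⋃_q g_q⁻¹ 𝒟ᵒ` with Mathlib's open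
  fundamental domain `𝒟ᵒ` of `SL(2, ℤ)`. The pieces are pairwise disjoint
  (`pairwise_disjoint_smul_fdo`) and two `Γ₀(N)`-equivalent points of `F` are equal
  (`eq_of_smul_eq_of_mem_fdo`) — both by Serre's theorem
  `ModularGroup.eq_one_or_neg_one_of_mem_fdo_mem_fdo` (only `±1` move a point of `𝒟ᵒ` into
  `𝒟ᵒ`) and `-1 ∈ Γ₀(N)`; every point none of whose `SL(2, ℤ)`-translates lies on the null set
  `𝒟 ∖ 𝒟ᵒ` is `Γ₀(N)`-equivalent into `F` (`exists_smul_mem_smul_fdo`,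
  `volume_setOf_exists_smul_mem_fd_diff_fdo`). So `F` is a fundamental domain up to null sets
  (Diamond–Shurman §2.3–2.4).
* **Unfolding.** `∫⁻_𝒟 ∑_q G(g_q⁻¹ τ) dμ = ∫⁻_F G dμ` (`setLIntegral_fd_sum_eq_setLIntegral_iUnion`:
  invariance of `dμ`, Mathlib `SMulInvariantMeasure (GL (Fin 2) ℝ) ℍ volume`, and
  `volume (𝒟 ∖ 𝒟ᵒ) = 0`, `Literature.NumberTheory.Automorphic.volume_modular_fd_diff_fdo`).
* **`dμ = y⁻² dx dy`.** `∫⁻_S H dμ = ∫⁻_{S ⊆ ℂ} y⁻² H dx dy` (`setLIntegral_eq_setLIntegral_image_coe`,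
  Mathlib's definition `UpperHalfPlane.volume_def`), and hyperbolically null sets are Lebesgue
  null (`volume_image_coe_eq_zero`).
* **The Petersson norm.** `(f, f)_{Γ₀(N)} = ∫⁻_𝒟 ∑_q |f(g_q⁻¹τ)|² (im g_q⁻¹τ)² dμ` as a real number
  (`peterssonProduct_self_eq_lintegral`), `= ∫⁻_F |f|² y² dμ` (`lintegral_fd_sum_eq_lintegral_domain`),
  and `∫⁻_S |f|² y² dμ = ∫⁻_{S ⊆ ℂ} |f|² dx dy` (`lintegral_domain_eq_lintegral_image`).

No new definitions are made.

## References

* D. Zagier, *Modular parametrizations of elliptic curves*, Canad. Math. Bull. 28 (1985),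
  372–384: §1, p. 374.
* F. Diamond, J. Shurman, *A First Course in Modular Forms*, GTM 228, Springer 2005: §2.3, §2.4,
  §5.4 (Def. 5.4.1, p. 182).
-/

noncomputable section

open scoped MatrixGroups ModularForm Modular Topology ENNReal NNReal
open MeasureTheory Filter Set Function ModularGroup CongruenceSubgroup
open UpperHalfPlane hiding I

namespace Literature.NumberTheory.EllipticCurves.ModularForms

/-! ### Coset representatives of `Γ₀(N)` in `SL(2, ℤ)` and the domain `⋃_q g_q⁻¹ 𝒟ᵒ` -/

section Domain

variable {N : ℕ}

/-- Every coset `q ∈ 𝒮ℒ / Γ₀(N)` has a representative in `SL(2, ℤ)` mapping to the chosen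
representative `q.out ∈ 𝒮ℒ ≤ GL(2, ℝ)`. [folklore] -/
theorem exists_mapGL_eq_out :
    ∃ g : (↥𝒮ℒ ⧸ (Gamma0 N : Subgroup (GL (Fin 2) ℝ)).subgroupOf 𝒮ℒ) → SL(2, ℤ),
      ∀ q, (Matrix.SpecialLinearGroup.mapGL ℝ (g q) : GL (Fin 2) ℝ) =
        ((q.out : ↥𝒮ℒ) : GL (Fin 2) ℝ) := by
  have h : ∀ q : (↥𝒮ℒ ⧸ (Gamma0 N : Subgroup (GL (Fin 2) ℝ)).subgroupOf 𝒮ℒ),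
      ∃ g : SL(2, ℤ), (Matrix.SpecialLinearGroup.mapGL ℝ g : GL (Fin 2) ℝ) =
      ((q.out : ↥𝒮ℒ) : GL (Fin 2) ℝ) := fun q ↦ q.out.2
  choose g hg using h
  exact ⟨g, hg⟩

variable (g : (↥𝒮ℒ ⧸ (Gamma0 N : Subgroup (GL (Fin 2) ℝ)).subgroupOf 𝒮ℒ) → SL(2, ℤ))
  (hg : ∀ q, (Matrix.SpecialLinearGroup.mapGL ℝ (g q) : GL (Fin 2) ℝ) = ((q.out : ↥𝒮ℒ) : GL (Fin 2) ℝ))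

include hg in
/-- Two cosets with representatives `g_q, g_r ∈ SL(2, ℤ)` coincide iff `g_q⁻¹ g_r ∈ Γ₀(N)`.
[folklore] -/
theorem coset_eq_iff (q r : (↥𝒮ℒ ⧸ (Gamma0 N : Subgroup (GL (Fin 2) ℝ)).subgroupOf 𝒮ℒ)) :
    q = r ↔ (g q)⁻¹ * g r ∈ Gamma0 N := by
  have h : q = r ↔
      (q.out : ↥𝒮ℒ)⁻¹ * r.out ∈ ((Gamma0 N : Subgroup (GL (Fin 2) ℝ)).subgroupOf 𝒮ℒ) := by
    rw [← QuotientGroup.eq, QuotientGroup.out_eq', QuotientGroup.out_eq']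
  rw [h, Subgroup.mem_subgroupOf, Subgroup.coe_mul, Subgroup.coe_inv, ← hg q, ← hg r, ← map_inv,
    ← map_mul]
  exact Subgroup.mem_map_iff_mem Matrix.SpecialLinearGroup.mapGL_injective

include hg in
/-- The coset of `s ∈ SL(2, ℤ)`: `g_q⁻¹ s ∈ Γ₀(N)` for `q = s Γ₀(N)`. [folklore] -/
theorem inv_mul_mem_Gamma0_of_mk (s : SL(2, ℤ)) :
    (g (QuotientGroup.mk (⟨Matrix.SpecialLinearGroup.mapGL ℝ s, s, rfl⟩ : ↥𝒮ℒ)))⁻¹ * s ∈ Gamma0 N := by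
  set a : ↥𝒮ℒ := ⟨Matrix.SpecialLinearGroup.mapGL ℝ s, s, rfl⟩ with ha
  set q : (↥𝒮ℒ ⧸ (Gamma0 N : Subgroup (GL (Fin 2) ℝ)).subgroupOf 𝒮ℒ) := QuotientGroup.mk a with hq
  have hmem : (q.out : ↥𝒮ℒ)⁻¹ * a ∈ ((Gamma0 N : Subgroup (GL (Fin 2) ℝ)).subgroupOf 𝒮ℒ) :=
    QuotientGroup.eq.mp (QuotientGroup.out_eq' q)
  rw [Subgroup.mem_subgroupOf, Subgroup.coe_mul, Subgroup.coe_inv, ← hg q] at hmem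
  rw [← Subgroup.mem_map_iff_mem (Matrix.SpecialLinearGroup.mapGL_injective (R := ℤ) (S := ℝ)),
    map_mul, map_inv]
  exact hmem

include hg in
/-- The translates `g_q⁻¹ 𝒟ᵒ` of the open fundamental domain by the inverses of a system of coset
representatives are pairwise disjoint (Serre's theorem `ModularGroup.eq_one_or_neg_one_of_mem_fdo_mem_fdo`:
only `±1` move a point of `𝒟ᵒ` into `𝒟ᵒ`, and `-1 ∈ Γ₀(N)`). [folklore] -/
theorem pairwise_disjoint_smul_fdo :
    Pairwise (Disjoint on fun q ↦ {τ : ℍ | g q • τ ∈ 𝒟ᵒ}) := by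
  intro q r hqr
  simp only [Function.onFun, Set.disjoint_left]

  intro τ hq hr
  apply hqr
  rw [coset_eq_iff g hg]
  have hmove : (g r * (g q)⁻¹) • (g q • τ) ∈ 𝒟ᵒ := by rwa [mul_smul, inv_smul_smul]
  rcases eq_one_or_neg_one_of_mem_fdo_mem_fdo hq hmove with h1 | h1
  · rw [mul_inv_eq_one] at h1
    rw [h1, inv_mul_cancel]
    exact one_mem _
  · rw [mul_inv_eq_iff_eq_mul] at h1
    rw [h1, neg_one_mul, mul_neg, inv_mul_cancel]
    simp [Gamma0_mem]

include hg in
/-- **At most one point per orbit**: if `τ ∈ g_q⁻¹ 𝒟ᵒ` and `τ' ∈ g_r⁻¹ 𝒟ᵒ` are `Γ₀(N)`-equivalent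
then `τ = τ'` (Serre's theorem again; the case `g_r γ g_q⁻¹ = -1` is reduced to `+1` by
replacing `γ` with `-γ`). [folklore] -/
theorem eq_of_smul_eq_of_mem_fdo {q r : (↥𝒮ℒ ⧸ (Gamma0 N : Subgroup (GL (Fin 2) ℝ)).subgroupOf 𝒮ℒ)}
    {τ τ' : ℍ} (hq : g q • τ ∈ 𝒟ᵒ) (hr : g r • τ' ∈ 𝒟ᵒ)
    {γ : SL(2, ℤ)} (hγ : γ ∈ Gamma0 N) (hγτ : γ • τ = τ') : τ = τ' := by
  -- the case `g r * γ * (g q)⁻¹ = 1`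
  have key : ∀ γ : SL(2, ℤ), γ ∈ Gamma0 N → γ • τ = τ' → g r * γ * (g q)⁻¹ = 1 → τ = τ' := by
    intro γ hγ hγτ h1
    have hqr : q = r := by
      rw [coset_eq_iff g hg]
      have : (g q)⁻¹ * g r = γ⁻¹ := by
        rw [mul_inv_eq_one] at h1
        rw [← h1, mul_inv_rev, inv_mul_cancel_right]
      rw [this]
      exact inv_mem hγ
    subst hqr
    have hγ1 : γ = 1 := by
      rw [mul_inv_eq_one] at h1
      exact mul_left_cancel (h1.trans (mul_one _).symm)
    rw [hγ1, one_smul] at hγτ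
    exact hγτ
  have hmove : (g r * γ * (g q)⁻¹) • (g q • τ) ∈ 𝒟ᵒ := by
    rwa [mul_smul, inv_smul_smul, mul_smul, hγτ]
  rcases eq_one_or_neg_one_of_mem_fdo_mem_fdo hq hmove with h1 | h1
  · exact key γ hγ hγτ h1
  · have hnγ : -γ ∈ Gamma0 N := by
      rw [← neg_one_mul]
      exact (Gamma0 N).mul_mem (by simp [Gamma0_mem]) hγ
    refine key (-γ) hnγ (by rw [SL_neg_smul, hγτ]) ?_
    rw [mul_neg, neg_mul, h1, neg_neg]

include hg in
/-- **Every orbit off a null set meets the domain**: if no `SL(2, ℤ)`-translate of `τ` lies on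
the boundary `𝒟 ∖ 𝒟ᵒ`, then some `Γ₀(N)`-translate of `τ` lies in some `g_q⁻¹ 𝒟ᵒ`
(Mathlib `ModularGroup.exists_smul_mem_fd`). [folklore] -/
theorem exists_smul_mem_smul_fdo {τ : ℍ} (hτ : ∀ s : SL(2, ℤ), s • τ ∈ 𝒟 → s • τ ∈ 𝒟ᵒ) :
    ∃ γ ∈ Gamma0 N, ∃ q, g q • γ • τ ∈ 𝒟ᵒ := by
  obtain ⟨s, hs⟩ := exists_smul_mem_fd τ
  have hso := hτ s hs
  refine ⟨_, inv_mul_mem_Gamma0_of_mk g hg s, QuotientGroup.mk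
    (⟨Matrix.SpecialLinearGroup.mapGL ℝ s, s, rfl⟩ : ↥𝒮ℒ), ?_⟩
  rwa [smul_smul, mul_inv_cancel_left]

/-- The set of points having an `SL(2, ℤ)`-translate on the boundary `𝒟 ∖ 𝒟ᵒ` is null for the
hyperbolic measure (countably many translates of a null set, `volume_modular_fd_diff_fdo`).
[folklore] -/
theorem volume_setOf_exists_smul_mem_fd_diff_fdo :
    volume {τ : ℍ | ∃ s : SL(2, ℤ), s • τ ∈ 𝒟 \ 𝒟ᵒ} = 0 := by
  haveI : Countable SL(2, ℤ) := countable_SL2Z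
  have hB : volume (⋃ s : SL(2, ℤ), (fun σ : ℍ ↦ s • σ) ⁻¹' (𝒟 \ 𝒟ᵒ)) = 0 := by
    refine measure_iUnion_null fun s ↦ ?_
    change volume ((fun σ : ℍ ↦ (Matrix.SpecialLinearGroup.mapGL ℝ s : GL (Fin 2) ℝ) • σ) ⁻¹'
      (𝒟 \ 𝒟ᵒ)) = 0
    rw [(measurePreserving_smul (Matrix.SpecialLinearGroup.mapGL ℝ s : GL (Fin 2) ℝ)
      (volume : Measure ℍ)).measure_preimage
      ((isClosed_fd.measurableSet.diff isOpen_fdo.measurableSet).nullMeasurableSet)]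
    exact Automorphic.volume_modular_fd_diff_fdo
  refine measure_mono_null (fun τ ⟨s, hs⟩ ↦ mem_iUnion.mpr ⟨s, hs⟩) hB

/-- The set of the previous lemma is measurable. [folklore] -/
theorem measurableSet_setOf_exists_smul_mem_fd_diff_fdo :
    MeasurableSet {τ : ℍ | ∃ s : SL(2, ℤ), s • τ ∈ 𝒟 \ 𝒟ᵒ} := by
  haveI : Countable SL(2, ℤ) := countable_SL2Z
  have : {τ : ℍ | ∃ s : SL(2, ℤ), s • τ ∈ 𝒟 \ 𝒟ᵒ} =
      ⋃ s : SL(2, ℤ), (fun σ : ℍ ↦ s • σ) ⁻¹' (𝒟 \ 𝒟ᵒ) := by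
    ext τ; simp
  rw [this]
  exact MeasurableSet.iUnion fun s ↦
    (isClosed_fd.measurableSet.diff isOpen_fdo.measurableSet).preimage
      (continuous_sl2z_smul s).measurable
    
/-- The pieces `{τ | g_q τ ∈ 𝒟ᵒ}` are open. [folklore] -/
theorem isOpen_setOf_smul_mem_fdo (s : SL(2, ℤ)) : IsOpen {τ : ℍ | s • τ ∈ 𝒟ᵒ} :=
  isOpen_fdo.preimage (continuous_sl2z_smul s)

/-- Change of variables `σ = g τ` in the hyperbolic measure:
`∫⁻_𝒟 G(g⁻¹ σ) dμ(σ) = ∫⁻_{g⁻¹ 𝒟} G dμ` (invariance of `dμ`, Mathlib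
`SMulInvariantMeasure (GL (Fin 2) ℝ) ℍ volume`). [folklore] -/
theorem setLIntegral_fd_comp_inv_smul (s : SL(2, ℤ)) (G : ℍ → ℝ≥0∞) :
    ∫⁻ σ in 𝒟, G (s⁻¹ • σ) = ∫⁻ τ in {τ : ℍ | s • τ ∈ 𝒟}, G τ := by
  have h := (measurePreserving_smul (Matrix.SpecialLinearGroup.mapGL ℝ s : GL (Fin 2) ℝ)
    (volume : Measure ℍ)).setLIntegral_comp_preimage_emb
    (measurableEmbedding_const_smul (Matrix.SpecialLinearGroup.mapGL ℝ s : GL (Fin 2) ℝ))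
    (fun σ ↦ G (s⁻¹ • σ)) 𝒟
  change ∫⁻ τ in {τ : ℍ | s • τ ∈ 𝒟}, G (s⁻¹ • s • τ) = _ at h
  simp_rw [inv_smul_smul] at h
  exact h.symm

/-- Replacing `𝒟` by its interior in the previous integral costs nothing (the boundary is
null). [folklore] -/
theorem setLIntegral_setOf_smul_mem_fd_eq (s : SL(2, ℤ)) (G : ℍ → ℝ≥0∞) :
    ∫⁻ τ in {τ : ℍ | s • τ ∈ 𝒟}, G τ = ∫⁻ τ in {τ : ℍ | s • τ ∈ 𝒟ᵒ}, G τ := by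
  refine setLIntegral_congr (ae_eq_set.mpr ⟨?_, ?_⟩)
  · change volume ((fun σ : ℍ ↦ (Matrix.SpecialLinearGroup.mapGL ℝ s : GL (Fin 2) ℝ) • σ) ⁻¹' 𝒟 \
      (fun σ : ℍ ↦ (Matrix.SpecialLinearGroup.mapGL ℝ s : GL (Fin 2) ℝ) • σ) ⁻¹' 𝒟ᵒ) = 0
    rw [← preimage_sdiff, (measurePreserving_smul (Matrix.SpecialLinearGroup.mapGL ℝ s : GL (Fin 2) ℝ)
      (volume : Measure ℍ)).measure_preimage
      ((isClosed_fd.measurableSet.diff isOpen_fdo.measurableSet).nullMeasurableSet)]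
    exact Automorphic.volume_modular_fd_diff_fdo
  · exact measure_mono_null (fun τ hτ ↦ hτ.2 (fdo_subset_fd hτ.1)) measure_empty

include hg in
/-- **Unfolding the Petersson integral onto the domain `F = ⋃_q g_q⁻¹ 𝒟ᵒ`**:
`∫⁻_𝒟 ∑_q G(g_q⁻¹ τ) dμ = ∫⁻_F G dμ` for every measurable `G ≥ 0`. [folklore] -/
theorem setLIntegral_fd_sum_eq_setLIntegral_iUnion
    [Fintype (↥𝒮ℒ ⧸ (Gamma0 N : Subgroup (GL (Fin 2) ℝ)).subgroupOf 𝒮ℒ)] {G : ℍ → ℝ≥0∞}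
    (hG : Measurable G) :
    ∫⁻ τ in 𝒟, ∑ q, G ((g q)⁻¹ • τ) = ∫⁻ τ in ⋃ q, {τ : ℍ | g q • τ ∈ 𝒟ᵒ}, G τ := by
  have h1 : ∫⁻ τ in 𝒟, ∑ q, G ((g q)⁻¹ • τ) = ∑ q, ∫⁻ τ in 𝒟, G ((g q)⁻¹ • τ) :=
    lintegral_finsetSum Finset.univ (f := fun q τ ↦ G ((g q)⁻¹ • τ)) fun q _ ↦
      hG.comp (continuous_sl2z_smul (g q)⁻¹).measurable
  rw [h1, lintegral_iUnion (fun q ↦ (isOpen_setOf_smul_mem_fdo (g q)).measurableSet)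
      (pairwise_disjoint_smul_fdo g hg), tsum_fintype]
  refine Finset.sum_congr rfl fun q _ ↦ ?_
  rw [setLIntegral_fd_comp_inv_smul, setLIntegral_setOf_smul_mem_fd_eq]

end Domain

/-! ### The hyperbolic measure against Lebesgue measure on `ℂ` -/

section MeasureTransfer

/-- The density `(im z)⁻²` of the hyperbolic measure `dμ = dx dy / y²` (Mathlib
`UpperHalfPlane.volume_def`) is continuous on `ℍ`. [folklore] -/
theorem continuous_hyperbolicDensity :
    Continuous fun z : ℍ ↦ ((1 / NNReal.mk z.im z.im_pos.le) ^ 2 : ℝ≥0) := by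
  refine .pow (.div₀ continuous_const ?_ ?_) _
  · exact continuous_im.subtype_mk _
  · exact fun x ↦ NNReal.ne_iff.mp x.im_ne_zero

/-- **`dμ = y⁻² dx dy` on sets**: the hyperbolic integral over a measurable `S ⊆ ℍ` of a measurable
`H ≥ 0` is the Lebesgue integral over `S ⊆ ℂ` of `(im z)⁻² H(z)` (Mathlib's definition of the
measure on `ℍ`, `UpperHalfPlane.volume_eq_lintegral`, with an integrand). [folklore] -/
theorem setLIntegral_eq_setLIntegral_image_coe {S : Set ℍ} (hS : MeasurableSet S) {H : ℍ → ℝ≥0∞}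
    (hH : Measurable H) :
    ∫⁻ τ in S, H τ =
      ∫⁻ z in ((↑) : ℍ → ℂ) '' S, ((1 / ‖z.im‖₊) ^ 2 : ℝ≥0) * H (ofComplex z) := by
  have hmp : MeasurePreserving ((↑) : ℍ → ℂ) (volume.comap ((↑) : ℍ → ℂ))
      (volume.restrict (range ((↑) : ℍ → ℂ))) :=
    ⟨measurable_coe, by rw [measurableEmbedding_coe.map_comap]⟩
  calc ∫⁻ τ in S, H τ
      = ∫⁻ τ in S, ((fun z : ℍ ↦ (((1 / NNReal.mk z.im z.im_pos.le) ^ 2 : ℝ≥0) : ℝ≥0∞)) * H) τ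
          ∂(volume.comap ((↑) : ℍ → ℂ)) := by
        rw [volume_def]
        exact setLIntegral_withDensity_eq_setLIntegral_mul _
          continuous_hyperbolicDensity.measurable.coe_nnreal_ennreal hH hS
    _ = ∫⁻ τ in ((↑) : ℍ → ℂ) ⁻¹' (((↑) : ℍ → ℂ) '' S),
          (fun z : ℂ ↦ (((1 / ‖z.im‖₊) ^ 2 : ℝ≥0) : ℝ≥0∞) * H (ofComplex z)) (τ : ℂ)
          ∂(volume.comap ((↑) : ℍ → ℂ)) := by
        rw [preimage_image_eq _ coe_injective]
        refine setLIntegral_congr_fun hS fun τ _ ↦ ?_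
        have hmk : NNReal.mk τ.im τ.im_pos.le = ‖(τ : ℂ).im‖₊ :=
          NNReal.eq (by
            rw [UpperHalfPlane.coe_im, coe_nnnorm, Real.norm_eq_abs, abs_of_pos τ.im_pos]; rfl)
        simp only [Pi.mul_apply, ofComplex_apply, hmk]
    _ = ∫⁻ z in ((↑) : ℍ → ℂ) '' S, (((1 / ‖z.im‖₊) ^ 2 : ℝ≥0) : ℝ≥0∞) * H (ofComplex z)
          ∂(volume.restrict (range ((↑) : ℍ → ℂ))) :=
        hmp.setLIntegral_comp_preimage_emb measurableEmbedding_coe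
          (fun z : ℂ ↦ (((1 / ‖z.im‖₊) ^ 2 : ℝ≥0) : ℝ≥0∞) * H (ofComplex z)) (((↑) : ℍ → ℂ) '' S)
    _ = _ := by
        rw [Measure.restrict_restrict (measurableEmbedding_coe.measurableSet_image.mpr hS),
          inter_eq_self_of_subset_left (image_subset_range _ _)]

/-- A hyperbolically null measurable subset of `ℍ` is Lebesgue-null in `ℂ` (the density `y⁻²`
does not vanish). [folklore] -/
theorem volume_image_coe_eq_zero {S : Set ℍ} (h0 : volume S = 0) :
    volume (((↑) : ℍ → ℂ) '' S) = 0 := by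
  rw [volume_def, withDensity_apply_eq_zero
    continuous_hyperbolicDensity.measurable.coe_nnreal_ennreal] at h0
  rw [← measurableEmbedding_coe.comap_apply]
  refine measure_mono_null (fun τ hτ ↦ ?_) h0
  have h1 : NNReal.mk τ.im τ.im_pos.le ≠ 0 := NNReal.ne_iff.mp τ.im_ne_zero
  have h2 : ((1 / NNReal.mk τ.im τ.im_pos.le) ^ 2 : ℝ≥0) ≠ 0 := pow_ne_zero _ (one_div_ne_zero h1)
  exact ⟨by exact_mod_cast h2, hτ⟩

/-- The Petersson integrand of `f` against itself is the non-negative real `|f(τ)|² (im τ)ᵏ`.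
[folklore] -/
theorem petersson_self_eq_ofReal (k : ℤ) (F : ℍ → ℂ) (τ : ℍ) :
    petersson k F F τ = ((‖F τ‖ ^ 2 * τ.im ^ k : ℝ) : ℂ) := by
  rw [petersson, Complex.conj_mul']
  push_cast
  ring

end MeasureTransfer

/-! ### The Petersson norm of `f` as a hyperbolic integral over the domain -/

section PeterssonNorm

variable {N : ℕ} (g : (↥𝒮ℒ ⧸ (Gamma0 N : Subgroup (GL (Fin 2) ℝ)).subgroupOf 𝒮ℒ) → SL(2, ℤ))
  (hg : ∀ q, (Matrix.SpecialLinearGroup.mapGL ℝ (g q) : GL (Fin 2) ℝ) = ((q.out : ↥𝒮ℒ) : GL (Fin 2) ℝ))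

include hg in
/-- **The Petersson norm as a non-negative integral**: with the tree's normalisation
(`peterssonProduct_eq_setIntegral`), `(f, f)_{Γ₀(N)}` is (the real number underlying) the
hyperbolic integral `∫⁻_𝒟 ∑_q |f(g_q⁻¹ τ)|² (im g_q⁻¹τ)² dμ`. [folklore] -/
theorem peterssonProduct_self_eq_lintegral [NeZero N]
    [Fintype (↥𝒮ℒ ⧸ (Gamma0 N : Subgroup (GL (Fin 2) ℝ)).subgroupOf 𝒮ℒ)] (f : CuspForm (Gamma0 N) 2) :
    peterssonProduct (Gamma0 N) 2 f f =
      ((∫⁻ τ in 𝒟, ∑ q, ENNReal.ofReal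
        (‖f ((g q)⁻¹ • τ)‖ ^ 2 * ((g q)⁻¹ • τ).im ^ 2)).toReal : ℂ) := by
  rw [peterssonProduct_eq_setIntegral]
  have hpt : ∀ q (τ : ℍ), petersson 2 ⇑f ⇑f (((q.out : ↥𝒮ℒ) : GL (Fin 2) ℝ)⁻¹ • τ) =
      ((‖f ((g q)⁻¹ • τ)‖ ^ 2 * ((g q)⁻¹ • τ).im ^ 2 : ℝ) : ℂ) := by
    intro q τ
    have hsm : ((q.out : ↥𝒮ℒ) : GL (Fin 2) ℝ)⁻¹ • τ = (g q)⁻¹ • τ := by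
      rw [← hg q, ← map_inv]; rfl
    rw [hsm, petersson_self_eq_ofReal]
    norm_cast
  simp_rw [hpt, ← Complex.ofReal_sum]
  rw [integral_complex_ofReal]
  congr 1
  have hcont : ∀ q : (↥𝒮ℒ ⧸ (Gamma0 N : Subgroup (GL (Fin 2) ℝ)).subgroupOf 𝒮ℒ),
      Continuous fun τ : ℍ ↦ ‖f ((g q)⁻¹ • τ)‖ ^ 2 * ((g q)⁻¹ • τ).im ^ 2 :=
    fun q ↦ (((ModularFormClass.continuous f).comp (continuous_sl2z_smul _)).norm.pow 2).mul
      ((continuous_im.comp (continuous_sl2z_smul _)).pow 2)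
  rw [integral_eq_lintegral_of_nonneg_ae (Eventually.of_forall fun τ ↦
      Finset.sum_nonneg fun q _ ↦ by positivity)
    (continuous_finsetSum _ fun q _ ↦ hcont q).aestronglyMeasurable]
  congr 1
  refine lintegral_congr fun τ ↦ ?_
  exact ENNReal.ofReal_sum_of_nonneg fun q _ ↦ by positivity

include hg in
/-- **Unfolding**: the same integral over the domain `F = ⋃_q g_q⁻¹ 𝒟ᵒ`,
`∫⁻_𝒟 ∑_q |f(g_q⁻¹τ)|² (im g_q⁻¹τ)² dμ = ∫⁻_F |f|² y² dμ` (Diamond–Shurman §5.4: the sum over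
coset representatives computes the integral over `X₀(N)`). [folklore] -/
theorem lintegral_fd_sum_eq_lintegral_domain
    [Fintype (↥𝒮ℒ ⧸ (Gamma0 N : Subgroup (GL (Fin 2) ℝ)).subgroupOf 𝒮ℒ)] (f : CuspForm (Gamma0 N) 2) :
    ∫⁻ τ in 𝒟, ∑ q, ENNReal.ofReal (‖f ((g q)⁻¹ • τ)‖ ^ 2 * ((g q)⁻¹ • τ).im ^ 2) =
      ∫⁻ τ in ⋃ q, {τ : ℍ | g q • τ ∈ 𝒟ᵒ}, ENNReal.ofReal (‖f τ‖ ^ 2 * τ.im ^ 2) :=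
  setLIntegral_fd_sum_eq_setLIntegral_iUnion g hg
    (G := fun τ ↦ ENNReal.ofReal (‖f τ‖ ^ 2 * τ.im ^ 2))
    (((ModularFormClass.continuous f).norm.pow 2).mul
      (continuous_im.pow 2)).measurable.ennreal_ofReal

/-- **Passing to `ℂ`**: `∫⁻_S |f|² y² dμ = ∫⁻_{S ⊆ ℂ} |f|² dx dy` (`dμ = y⁻² dx dy`). [folklore] -/
theorem lintegral_domain_eq_lintegral_image {S : Set ℍ} (hS : MeasurableSet S)
    {Γ : Subgroup (GL (Fin 2) ℝ)} {k : ℤ} (f : CuspForm Γ k) :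
    ∫⁻ τ in S, ENNReal.ofReal (‖f τ‖ ^ 2 * τ.im ^ 2) =
      ∫⁻ z in ((↑) : ℍ → ℂ) '' S, ENNReal.ofReal (‖f (ofComplex z)‖ ^ 2) := by
  rw [setLIntegral_eq_setLIntegral_image_coe hS (H := fun τ ↦ ENNReal.ofReal (‖f τ‖ ^ 2 * τ.im ^ 2))
    (((ModularFormClass.continuous f).norm.pow 2).mul
      (continuous_im.pow 2)).measurable.ennreal_ofReal]
  refine setLIntegral_congr_fun (measurableEmbedding_coe.measurableSet_image.mpr hS) ?_
  rintro _ ⟨τ, _, rfl⟩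
  dsimp only
  rw [ofComplex_apply, UpperHalfPlane.coe_im, ENNReal.ofReal_mul (sq_nonneg _), mul_left_comm]
  conv_rhs => rw [← mul_one (ENNReal.ofReal (‖f τ‖ ^ 2))]
  congr 1
  rw [ENNReal.ofReal, ← ENNReal.coe_mul, ENNReal.coe_eq_one]
  apply NNReal.eq
  push_cast [Real.coe_toNNReal _ (sq_nonneg τ.im)]
  rw [Real.norm_eq_abs, abs_of_pos τ.im_pos]
  field_simp

end PeterssonNorm

end Literature.NumberTheory.EllipticCurves.ModularForms

end
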